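import Literature.MathematicalPhysics.QuantumFieldTheory.Balaban1983to89.T4Genealogy
import Literature.MathematicalPhysics.QuantumFieldTheory.Balaban1983to89.T4BankAgeYoung
import Literature.MathematicalPhysics.QuantumFieldTheory.Balaban1983to89.T4EpochSize

/-!
# `Balaban1983to89.T4GenealogyLifetime` — LEMMA Y ON THE GENEALOGY LEDGER, COMPOSED BY NAME
(cell `pub-balaban`, rung (B)+1, node U5; record `t4/T4-EST-U5E-rem.md` §4 (unit `b2b-balaban-pv25`); NEW leaf module,
imports `…T4Genealogy` (p183565), `…T4BankAgeYoung` (p182815) and `…T4EpochSize` (p183023) — all of that lineage — and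
modifies nothing; drafted by unit `b2b-balaban-pv25` gen 7, kernel-checked (one typeclass binder `[DecidableEq κ]` added,
§3 added) and proposed by unit `b2b-balaban-pv18` gen 10 under T4-DAG v14 row `T4-U5.E-REM-GENEALOGY-CAP°` — the check ran
on a SOURCE TWIN (the bodies of the three imported tree modules followed by this file, byte-identical parts) because the
farm snapshot did not yet carry their oleans; the twin and its negative control are archived with the cell records)
v1.1 (unit `b2b-balaban-pv18` gen 11, T4-DAG v15 row `T4-U5.E-REM-GENEALOGY-CAP-v1.1°`): §4 ADDED — the `_rescaled` /
`_four` variants of §§1–2 (new-part constant `q·(2·14^d)`, resp. the model's `4·14^d`, absorbed into the threshold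
(P5_q) / (P5₂)) and their non-vacuity; ADDITIVE ONLY: every v1 declaration is byte-identical, nothing imported changed.

HONEST FRAMING (cell `pub-balaban`, T4-DAG PAGE 1).  The cell's T4 target is the existence AND uniqueness of the
continuum limit of Bałaban's unit-scale averaged loop expectations on a finite torus — strictly beyond ultraviolet
stability ([Balaban1989LargeFieldII] Thm 1 p. 355); it is NOT the Yang–Mills mass gap and NOT the Clay problem.  This
module is COMPOSITION ONLY [folklore]: three kernel theorems of this lineage are applied to one another BY NAME.  NOTHING of
[Balaban1989LargeFieldII], [Balaban1988RG2Cluster] or [Balaban1987RG1] is asserted here: no quotation, no page claim, no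
`[cite:]` tag; every printed / analytic input is a BINDER of the theorems below, named in their docstrings.

WHAT THIS MODULE ADDS (all kernel-checked).  `…T4BankAgeYoung.lifetime_lt` (LEMMA Y's kernel skeleton: small bank ⇒
recent creation) takes the DATA `Ψ f v σ` of one sub-history through eight binders `hf hv hΨ0 hfound hstep hD hV hσ`;
`…T4Genealogy` DEFINES those data from a genealogy `Ledger` of the sub-history and PROVES the eight binders
(`Ledger.lifetime_binders_two`) from the ledger's well-formedness `WF`, the two SIZE INPUTS (per foundation `hfnd`, per
event `hev`) and the two counts `E ≤ m`, `Dtot ≤ D`; until now the two met only BY SHAPE (probe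
`ComposeProbe-T4Genealogy-lifetime_lt.lean`, cell GAPS C-pv25g7-1; independent Π-type composition by the cross-reader,
C-pv01-61).  Here they meet in the kernel:
* §1 `lifetime_lt_of_ledger` — LEMMA Y for a well-formed ledger: the conclusion of `lifetime_lt`
  (`Σ_{i≤m} len i < A·epochAllowance d C R_max A`) from `WF`, `hfnd`, `hev`, `E ≤ m`, `Dtot ≤ D`, the S-side bank
  hypotheses `hce hp hP5 hb hbA` and the profile / horizon binders `hint hhalf hlen hR` of `lifetime_lt`, the eight data
  binders being DISCHARGED (`obtain` + `exact`, no rewriting); `lifetime_lt_flow_of_ledger` — the same with the typed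
  (2.5) windows of a flow (`…T4BankAgeYoung.lifetime_lt_flow`); `lifetime_lt_youngWindow_of_ledger` — the link (Y3)
  (`…T4BankAgeYoung.lifetime_lt_youngWindow`: lifetime `< youngAllowance ≤ youngWindow` at `A = ageCut C′ K`).
* §2 `lifetime_lt_of_ledger_cover` — in addition the profile binders `hint` / `hhalf` DISCHARGED ON THE CELL'S MODEL by
  `…T4EpochSize.coverProfile_int` / `coverProfile_halving`: the profile of epoch `i` is the COVER PROFILE
  `T4EpochSize.coverProfile L₀ (sc i) (hor i) (Z i)` of an epoch base `Z i` (non-empty, face-connected, scale ratio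
  `L₀ ≥ 4`, drop control `B16SProfile.DropCtl (sc i) (hor i)` on the epoch's horizon) whose model size is at most the
  ledger's epoch-start size, `treeLen (Z i) ≤ σ i` (the binder `hZσ` — THIS is where the identification «print's d′_j =
  the model's `treeLen`» is consumed for the epoch bases; cf. `…T4SizeLedger`'s header).  What then remains of
  `lifetime_lt`'s binders is: the S-side bank reading (`hce hp hP5 hb hbA` with `E ≤ m`, `Dtot ≤ D`), the two size
  inputs `hfnd` / `hev` (discharged separately, on the size model, by `…T4SizeLedger.foundation_hfound` / `event_size_le`
  with `…T4EpochSize.epochSize_le_modelC` and `…T4Enlargement.hnew_collar_two/three` — NOT composed here: that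
  composition needs a geometric realisation of the ledger, i.e. a region per lineage and epoch, which this file does not
  posit), the printed horizon `hlen` («K ≤ n₀ − j + R_j», [Balaban1989LargeFieldII] p. 385 — a LOCATION, read in the
  record, not asserted) with its window bound `hR`, and the READING that a printed sub-history is a well-formed ledger
  (`…T4Genealogy` header (iv)).
* §3 `lifetime_lt_of_ledger_nonvacuous` — NON-VACUITY: every binder of `lifetime_lt_of_ledger` is discharged by
  evaluation on the two-founder / one-merger ledger `…T4Genealogy.Ledger.twoMerge` (`C = 1`, `d = 1`, `m = E = 1`,
  `D = Dtot = 2`, `ce = cs = p₀ = 1`, `b = 3`, `A = 4`, zero profiles / windows / lifetimes) and the theorem is applied —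
  the hypothesis list is jointly inhabited by a ledger with a genuine event (inhabitation only; nothing about print).
* §4 (v1.1) `lifetime_lt_of_ledger_rescaled` / `lifetime_lt_flow_of_ledger_rescaled` /
  `lifetime_lt_youngWindow_of_ledger_rescaled` / `lifetime_lt_of_ledger_cover_rescaled` — §§1–2 with the size inputs
  `hfnd` / `hev` carrying a new-part constant `q·(2·14^d)` (`q ≥ 1`; data binders by `Ledger.lifetime_binders` at
  `a = q·(2·14^d)`) and the threshold (P5_q) `q·c_e ≤ c_s·p̄₀` of `…T4BankAgeYoung` v1.1 §9 (`lifetime_lt_rescaled` and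
  its flow / young-window forms) in place of (P5); and the MODEL INSTANCE `q = 2` — `lifetime_lt_of_ledger_four` /
  `…_flow_of_ledger_four` / `…_youngWindow_of_ledger_four` / `…_of_ledger_cover_four` with the `4·14^d`-shapes of
  `Ledger.lifetime_binders_four` (the constant of `…T4Enlargement.hnew_collar_three`; on a geometric realisation these
  are literally `…T4GeometricLedger.hfnd_of_geometric` / `hev_of_geometric`) and (P5₂) `2·c_e ≤ c_s·p̄₀`, the birth
  total `Dtot ≤ D` UNDOUBLED — the by-name twin of `…T4GeometricLedger`'s doubled booking `toLedger₂` (which pays the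
  same constant in the masses, `Dtot₂ = 2·Dtot ≤ D`, keeping (P5)); `lifetime_lt_of_ledger_four_nonvacuous` — joint
  inhabitation of the (P5₂) list on `twoMerge` (`c_s = 2`, `b = 5`, `A = 6`).  Same conclusions; nothing printed
  asserted.
Cell census: kernel composition of the pv25 lineage's skeleton on the cell's MODEL, NOT summit progress; NOT continuum,
NOT Clay.
-/

namespace Literature.MathematicalPhysics.QuantumFieldTheory.Balaban1983to89.T4GenealogyLifetime

open Finset

variable {κ : Type*} [DecidableEq κ]

/-! ## §1 Lemma Y for a well-formed genealogy ledger -/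

section Ledger

/-- **LEMMA Y ON THE GENEALOGY LEDGER.**  For a well-formed ledger `L` (`…T4Genealogy.Ledger.WF`) with the two size
inputs in the shapes of `…T4SizeLedger` (`hfnd`: per foundation `size ℓ + 1 ≤ 2·14^d·fmass ℓ`; `hev`: per event
`size (product e) + 2 ≤ C·Σ_{consumed}(size + 1) + 2·#consumed + 2·14^d·gmass e`), at most `m` events and total booked
birth mass `≤ D` (the S-side CREDIT READING, binders `hm hDD`), the bank hypotheses `hce hp hP5 hb hbA` and the profile /
horizon binders `hint hhalf hlen hR` of `…T4BankAgeYoung.lifetime_lt` (stated over the ledger's own epoch-start sizes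
`L.σ`): the lifetime is `< A·epochAllowance d C R_max A`.  The eight data binders of `lifetime_lt` are supplied by
`Ledger.lifetime_binders_two`. [folklore] -/
theorem lifetime_lt_of_ledger (L : T4Genealogy.Ledger κ) (hW : L.WF) {C : ℝ} (hC : 1 ≤ C) {d : ℕ} (hd : 1 ≤ d)
    (hfnd : ∀ e, e ≤ L.E → ∀ ℓ ∈ L.founded e, L.size ℓ + 1 ≤ 2 * 14 ^ d * L.fmass ℓ)
    (hev : ∀ e, e < L.E → L.size (L.product e) + 2 ≤
      C * ∑ ℓ ∈ L.consumed e, (L.size ℓ + 1) + 2 * ((L.consumed e).card : ℝ) + 2 * 14 ^ d * L.gmass e)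
    {m D A : ℕ} (hm : L.E ≤ m) (hDD : L.Dtot ≤ (D : ℝ))
    {ce cs p₀ b : ℝ} (hce : 0 < ce) (hp : 0 < p₀) (hP5 : ce ≤ cs * p₀)
    (hb : ce * p₀ * m + cs * p₀ ^ 2 * D ≤ b) (hbA : b < ce * p₀ * A)
    {R : ℕ → ℝ} {d' : ℕ → ℕ → ℝ} {len : ℕ → ℕ} {Rmax : ℝ} (hRmax : 0 ≤ Rmax)
    (hint : ∀ i, i ≤ m → ∀ k, 0 < d' i k → 1 ≤ d' i k)
    (hhalf : ∀ i, i ≤ m → ∀ k, 1 < k → d' i k ≤ (1 / 2) ^ k * L.σ i)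
    (hlen : ∀ i, i ≤ m → ∃ k : ℕ, (k = 0 ∨ 0 < d' i k) ∧ (len i : ℝ) ≤ k + R i)
    (hR : ∀ i, i ≤ m → R i ≤ Rmax) :
    (∑ i ∈ Finset.range (m + 1), (len i : ℝ)) < A * T4BankAgeYoung.epochAllowance d C Rmax A := by
  obtain ⟨hf, hv, hΨ0, hfound, hstep, hD, hV, hσ⟩ := L.lifetime_binders_two hW hC hd hfnd hev hm hDD
  exact T4BankAgeYoung.lifetime_lt hce hp hP5 hb hbA hC d hf hv hΨ0 hfound hstep hD hV hRmax hσ hint hhalf hlen hR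

/-- **LEMMA Y ON THE GENEALOGY LEDGER, WITH THE FLOW** (`…T4BankAgeYoung.lifetime_lt_flow`): as
`lifetime_lt_of_ledger`, the windows being the typed (2.5) windows `R (s i)` at the epochs' start scales `s i ≤ K` of a
flow obeying (I.0.20) up to `K` with `β ≤ β′` and couplings in `]0, 1]`; the lifetime is
`< A·epochAllowance d C (windowMax L₁ r x̄ c̄ K) A`. [folklore] -/
theorem lifetime_lt_flow_of_ledger (L : T4Genealogy.Ledger κ) (hW : L.WF) {C : ℝ} (hC : 1 ≤ C) {d : ℕ}
    (hd : 1 ≤ d)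
    (hfnd : ∀ e, e ≤ L.E → ∀ ℓ ∈ L.founded e, L.size ℓ + 1 ≤ 2 * 14 ^ d * L.fmass ℓ)
    (hev : ∀ e, e < L.E → L.size (L.product e) + 2 ≤
      C * ∑ ℓ ∈ L.consumed e, (L.size ℓ + 1) + 2 * ((L.consumed e).card : ℝ) + 2 * 14 ^ d * L.gmass e)
    {m D A : ℕ} (hm : L.E ≤ m) (hDD : L.Dtot ≤ (D : ℝ))
    {ce cs p₀ b : ℝ} (hce : 0 < ce) (hp : 0 < p₀) (hP5 : ce ≤ cs * p₀)
    (hb : ce * p₀ * m + cs * p₀ ^ 2 * D ≤ b) (hbA : b < ce * p₀ * A)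
    {d' : ℕ → ℕ → ℝ} {len : ℕ → ℕ}
    (hint : ∀ i, i ≤ m → ∀ k, 0 < d' i k → 1 ≤ d' i k)
    (hhalf : ∀ i, i ≤ m → ∀ k, 1 < k → d' i k ≤ (1 / 2) ^ k * L.σ i)
    (F : Flow) (K : ℕ) {β' : ℝ} (hβ' : 0 ≤ β') {L₁ r : ℕ} (hL : 1 ≤ L₁)
    (hpos : ∀ j, j ≤ K → 0 < F.g j) (hle1 : ∀ j, j ≤ K → F.g j ≤ 1) (hrg : F.SatisfiesRG K)
    (hub : ∀ j, j < K → F.β (j + 1) (F.g j) ≤ β') (R : ℕ → ℕ) (hRj : ∀ j, j ≤ K → B14.IsRj L₁ r (F.g j) (R j))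
    {x c : ℝ} (hx : 0 ≤ x) (hc : 0 ≤ c) (hxK : Real.log ((F.g K) ^ 2)⁻¹ ≤ x) (hcK : (F.g K) ^ 2 * β' ≤ c)
    {s : ℕ → ℕ} (hs : ∀ i, i ≤ m → s i ≤ K)
    (hlen : ∀ i, i ≤ m → ∃ k : ℕ, (k = 0 ∨ 0 < d' i k) ∧ (len i : ℝ) ≤ k + R (s i)) :
    (∑ i ∈ Finset.range (m + 1), (len i : ℝ)) <
      A * T4BankAgeYoung.epochAllowance d C (T4BankAgeYoung.windowMax L₁ r x c K) A := by
  obtain ⟨hf, hv, hΨ0, hfound, hstep, hD, hV, hσ⟩ := L.lifetime_binders_two hW hC hd hfnd hev hm hDD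
  exact T4BankAgeYoung.lifetime_lt_flow hce hp hP5 hb hbA hC d hf hv hΨ0 hfound hstep hD hV hσ hint hhalf F K hβ'
    hL hpos hle1 hrg hub R hRj hx hc hxK hcK hs hlen

/-- **THE LINK (Y3) ON THE GENEALOGY LEDGER** (`…T4BankAgeYoung.lifetime_lt_youngWindow`): at `A = ageCut C′ K` the
lifetime is `< youngAllowance d L₁ r C C′ x̄ c̄ K ≤ youngWindow … K` — the sub-history was created within the window the
summable young rate allows. [folklore] -/
theorem lifetime_lt_youngWindow_of_ledger (L : T4Genealogy.Ledger κ) (hW : L.WF) {C : ℝ} (hC : 1 ≤ C) {d : ℕ}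
    (hd : 1 ≤ d)
    (hfnd : ∀ e, e ≤ L.E → ∀ ℓ ∈ L.founded e, L.size ℓ + 1 ≤ 2 * 14 ^ d * L.fmass ℓ)
    (hev : ∀ e, e < L.E → L.size (L.product e) + 2 ≤
      C * ∑ ℓ ∈ L.consumed e, (L.size ℓ + 1) + 2 * ((L.consumed e).card : ℝ) + 2 * 14 ^ d * L.gmass e)
    {m D : ℕ} {C' : ℝ} {K : ℕ} (hm : L.E ≤ m) (hDD : L.Dtot ≤ (D : ℝ))
    {ce cs p₀ b : ℝ} (hce : 0 < ce) (hp : 0 < p₀) (hP5 : ce ≤ cs * p₀)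
    (hb : ce * p₀ * m + cs * p₀ ^ 2 * D ≤ b) (hbA : b < ce * p₀ * (T4RemnantBooking.ageCut C' K))
    {d' : ℕ → ℕ → ℝ} {len : ℕ → ℕ}
    (hint : ∀ i, i ≤ m → ∀ k, 0 < d' i k → 1 ≤ d' i k)
    (hhalf : ∀ i, i ≤ m → ∀ k, 1 < k → d' i k ≤ (1 / 2) ^ k * L.σ i)
    (F : Flow) {β' : ℝ} (hβ' : 0 ≤ β') {L₁ r : ℕ} (hL : 1 ≤ L₁)
    (hpos : ∀ j, j ≤ K → 0 < F.g j) (hle1 : ∀ j, j ≤ K → F.g j ≤ 1) (hrg : F.SatisfiesRG K)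
    (hub : ∀ j, j < K → F.β (j + 1) (F.g j) ≤ β') (R : ℕ → ℕ) (hRj : ∀ j, j ≤ K → B14.IsRj L₁ r (F.g j) (R j))
    {x c : ℝ} (hx : 0 ≤ x) (hc : 0 ≤ c) (hxK : Real.log ((F.g K) ^ 2)⁻¹ ≤ x) (hcK : (F.g K) ^ 2 * β' ≤ c)
    {s : ℕ → ℕ} (hs : ∀ i, i ≤ m → s i ≤ K)
    (hlen : ∀ i, i ≤ m → ∃ k : ℕ, (k = 0 ∨ 0 < d' i k) ∧ (len i : ℝ) ≤ k + R (s i)) :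
    (∑ i ∈ Finset.range (m + 1), (len i : ℝ)) < T4BankAgeYoung.youngAllowance d L₁ r C C' x c K ∧
      (∑ i ∈ Finset.range (m + 1), (len i : ℝ)) < (T4BankAgeYoung.youngWindow d L₁ r C C' x c K : ℝ) := by
  obtain ⟨hf, hv, hΨ0, hfound, hstep, hD, hV, hσ⟩ := L.lifetime_binders_two hW hC hd hfnd hev hm hDD
  exact T4BankAgeYoung.lifetime_lt_youngWindow hce hp hP5 hb hbA hC d hf hv hΨ0 hfound hstep hD hV hσ hint hhalf F
    hβ' hL hpos hle1 hrg hub R hRj hx hc hxK hcK hs hlen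

end Ledger

/-! ## §2 The profile binders discharged on the model: cover profiles of the epoch bases -/

section Cover

/-- **LEMMA Y ON THE GENEALOGY LEDGER WITH THE COVER PROFILES OF `…T4EpochSize`.**  As `lifetime_lt_of_ledger`, the
profile of epoch `i ≤ m` now BEING the cover profile `T4EpochSize.coverProfile L₀ (sc i) (hor i) (Z i)` of an epoch base
`Z i ⊂ ℤᵈ` (non-empty, face-connected; scale ratio `L₀ ≥ 4`; drop control `B16SProfile.DropCtl (sc i) (hor i)` of the
small-field exponents on the epoch's horizon `hor i`) whose model size is at most the ledger's epoch-start size,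
`treeLen (Z i) ≤ L.σ i` (binder `hZσ`: the identification of print's `d′_j` with the model's `treeLen`, consumed here for
the epoch bases): the binders `hint` (a positive profile value is `≥ 1`, `coverProfile_int`) and `hhalf` (halving from
`k = 2` on, `coverProfile_halving`) of `lifetime_lt` are DISCHARGED, and the horizon binder reads
`len i ≤ k + R i` for an index `k` that is `0` or has a cover of positive size. [folklore] -/
theorem lifetime_lt_of_ledger_cover (L : T4Genealogy.Ledger κ) (hW : L.WF) {C : ℝ} (hC : 1 ≤ C) {d : ℕ}
    (hd : 1 ≤ d)
    (hfnd : ∀ e, e ≤ L.E → ∀ ℓ ∈ L.founded e, L.size ℓ + 1 ≤ 2 * 14 ^ d * L.fmass ℓ)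
    (hev : ∀ e, e < L.E → L.size (L.product e) + 2 ≤
      C * ∑ ℓ ∈ L.consumed e, (L.size ℓ + 1) + 2 * ((L.consumed e).card : ℝ) + 2 * 14 ^ d * L.gmass e)
    {m D A : ℕ} (hm : L.E ≤ m) (hDD : L.Dtot ≤ (D : ℝ))
    {ce cs p₀ b : ℝ} (hce : 0 < ce) (hp : 0 < p₀) (hP5 : ce ≤ cs * p₀)
    (hb : ce * p₀ * m + cs * p₀ ^ 2 * D ≤ b) (hbA : b < ce * p₀ * A)
    -- the epoch bases on the model and their cover profiles
    {L₀ : ℕ} (hL₀ : 4 ≤ L₀) {sc : ℕ → ℕ → ℕ} {hor : ℕ → ℕ}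
    (hdrop : ∀ i, i ≤ m → B16SProfile.DropCtl (sc i) (hor i))
    {Z : ℕ → Finset (B13ScaleTransfer.Pt d)} (hZ : ∀ i, i ≤ m → (Z i).Nonempty)
    (hZc : ∀ i, i ≤ m → B13ScaleTransfer.FaceConnected (Z i))
    (hZσ : ∀ i, i ≤ m → TreeLength.treeLen (Z i) ≤ L.σ i)
    {R : ℕ → ℝ} {len : ℕ → ℕ} {Rmax : ℝ} (hRmax : 0 ≤ Rmax)
    (hlen : ∀ i, i ≤ m → ∃ k : ℕ, (k = 0 ∨ 0 < T4EpochSize.coverProfile L₀ (sc i) (hor i) (Z i) k) ∧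
      (len i : ℝ) ≤ k + R i)
    (hR : ∀ i, i ≤ m → R i ≤ Rmax) :
    (∑ i ∈ Finset.range (m + 1), (len i : ℝ)) < A * T4BankAgeYoung.epochAllowance d C Rmax A := by
  have hint : ∀ i, i ≤ m → ∀ k, 0 < T4EpochSize.coverProfile L₀ (sc i) (hor i) (Z i) k →
      1 ≤ T4EpochSize.coverProfile L₀ (sc i) (hor i) (Z i) k :=
    fun i _ => T4EpochSize.coverProfile_int (Z i)
  have hhalf : ∀ i, i ≤ m → ∀ k, 1 < k →
      T4EpochSize.coverProfile L₀ (sc i) (hor i) (Z i) k ≤ (1 / 2) ^ k * L.σ i := by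
    intro i hi k hk
    have h1 := T4EpochSize.coverProfile_halving hL₀ (hdrop i hi) (hZ i hi) (hZc i hi) k hk
    have h2 : (1 / 2 : ℝ) ^ k * TreeLength.treeLen (Z i) ≤ (1 / 2) ^ k * L.σ i :=
      mul_le_mul_of_nonneg_left (hZσ i hi) (by positivity)
    exact h1.trans h2
  exact lifetime_lt_of_ledger L hW hC hd hfnd hev hm hDD hce hp hP5 hb hbA
    (d' := fun i => T4EpochSize.coverProfile L₀ (sc i) (hor i) (Z i)) hRmax hint hhalf hlen hR

end Cover

/-! ## §3 Non-vacuity -/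

section NonVacuity

open T4Genealogy T4Genealogy.Ledger

/-- NON-VACUITY: the hypotheses of `lifetime_lt_of_ledger` are JOINTLY INHABITED by a ledger with a genuine event —
`T4Genealogy.Ledger.twoMerge` (two founders of size `1` and mass `1`, merged by the one event into a lineage of size `5`,
no new parts; `…T4Genealogy` §5) — with `C = 1`, `d = 1`, `m = E = 1`, `D = 2 = Dtot`, `ce = cs = p₀ = 1`, `b = 3`,
`A = 4`, zero profiles `d′ ≡ 0`, zero windows `R ≡ 0 = R_max` and zero lifetimes `len ≡ 0`; every binder is discharged
by evaluation and the theorem is APPLIED, its conclusion reading `Σ_{i ≤ 1} 0 < 4·epochAllowance 1 1 0 4`.  (This checks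
inhabitation of the hypothesis list only; it says nothing about print.) [folklore] -/
theorem lifetime_lt_of_ledger_nonvacuous :
    twoMerge.WF ∧ twoMerge.E = 1 ∧ twoMerge.Dtot = 2 ∧
    (∑ i ∈ Finset.range (1 + 1), ((fun _ : ℕ => (0 : ℕ)) i : ℝ)) <
      ((4 : ℕ) : ℝ) * T4BankAgeYoung.epochAllowance 1 1 0 4 := by
  have hW : twoMerge.WF := by
    refine ⟨by simp [twoMerge], ?_, ?_, ?_, ?_⟩
    · intro e he
      have he0 : e = 0 := by simp [twoMerge] at he; omega
      subst he0
      simp [twoMerge]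
    · intro ℓ; simp only [twoMerge]; split_ifs <;> norm_num
    · intro e ℓ _; simp [twoMerge]
    · intro e; simp [twoMerge]
  have hE : twoMerge.E = 1 := rfl
  have hDtot : twoMerge.Dtot = 2 := by
    rw [Dtot, hE, Finset.sum_range_succ, Finset.sum_range_one, f_zero,
      twoMerge.f_succ_of_lt (show 0 < twoMerge.E from by rw [hE]; exact Nat.one_pos)]
    norm_num [twoMerge]
  have hfnd : ∀ e, e ≤ twoMerge.E → ∀ ℓ ∈ twoMerge.founded e,
      twoMerge.size ℓ + 1 ≤ 2 * 14 ^ (1 : ℕ) * twoMerge.fmass ℓ := by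
    intro e _ ℓ hℓ
    simp only [twoMerge] at hℓ ⊢
    split_ifs at hℓ with h
    · simp at hℓ
      rcases hℓ with rfl | rfl <;> norm_num
    · simp at hℓ
  have hev : ∀ e, e < twoMerge.E → twoMerge.size (twoMerge.product e) + 2 ≤
      1 * ∑ ℓ ∈ twoMerge.consumed e, (twoMerge.size ℓ + 1) + 2 * ((twoMerge.consumed e).card : ℝ)
        + 2 * 14 ^ (1 : ℕ) * twoMerge.gmass e := by
    intro e he
    have he0 : e = 0 := by simp [twoMerge] at he; omega
    subst he0
    simp [twoMerge]
    norm_num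
  have hσnn : ∀ i, 0 ≤ twoMerge.σ i := by
    intro i
    cases i with
    | zero => simpa using hW.size_nonneg twoMerge.base₀
    | succ e =>
      by_cases he : e < twoMerge.E
      · rw [twoMerge.σ_succ_of_lt he]; exact hW.size_nonneg _
      · rw [twoMerge.σ_succ_of_le (not_lt.mp he)]
  refine ⟨hW, hE, hDtot, ?_⟩
  exact lifetime_lt_of_ledger twoMerge hW (C := 1) le_rfl (d := 1) le_rfl hfnd hev (m := 1) (D := 2) (A := 4)
    (by rw [hE]) (by rw [hDtot]; norm_num) (ce := 1) (cs := 1) (p₀ := 1) (b := 3) one_pos one_pos (by norm_num)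
    (by norm_num) (by norm_num) (R := fun _ => 0) (d' := fun _ _ => 0) (len := fun _ => 0) (Rmax := 0) le_rfl
    (fun i _ k hk => absurd hk (lt_irrefl _))
    (fun i _ k _ => by simpa using mul_nonneg (by positivity : (0 : ℝ) ≤ (1 / 2) ^ k) (hσnn i))
    (fun i _ => ⟨0, Or.inl rfl, by simp⟩) (fun i _ => le_rfl)

end NonVacuity

/-! ## §4 (v1.1) Rescaled birth unit on the ledger: new-part constant `q·(2·14^d)`; the model instance `4·14^d`

On the cell's MODEL the new-part (enlargement) constant is `4·14^d` (`…T4Enlargement.hnew_collar_three`), not the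
`2·14^d` of the literal shapes of `…T4BankAgeYoung.lifetime_lt`; `…T4Genealogy.Ledger.lifetime_binders` proves the
eight data binders for ANY new-part constant `a` (instances `lifetime_binders_two`, `lifetime_binders_four`), and
`…T4BankAgeYoung` v1.1 §9 absorbs `a = q·(2·14^d)` (`q ≥ 1` a natural number) into the threshold (P5_q)
`q·c_e ≤ c_s·p̄₀` (`lifetime_lt_rescaled`, `lifetime_lt_flow_rescaled`, `lifetime_lt_youngWindow_rescaled`; `q = 2`:
`lifetime_lt_four`, `lifetime_lt_youngWindow_four`).  This section composes the two BY NAME, exactly as §§1–2 do for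
`a = 2·14^d`: the size inputs `hfnd` / `hev` are taken in the `q·(2·14^d)`-shapes (§4a) resp. the `4·14^d`-shapes (§4b)
— for `q = 2` these are LITERALLY the shapes established on a geometric realisation of the ledger by
`…T4GeometricLedger.hfnd_of_geometric` / `hev_of_geometric` (that module imports this one, so the end-to-end composition
on the undoubled ledger `toLedger` is stated there or by a consumer, not here) — and the price of the model's constant
is paid in the THRESHOLD, (P5₂) `2·c_e ≤ c_s·p̄₀`, with the birth total `Dtot ≤ D` UNDOUBLED: the by-name twin of
`…T4GeometricLedger`'s doubled booking `toLedger₂` (masses `2·(treeLen + 1)`, `Dtot₂ = 2·Dtot ≤ D`, threshold (P5)).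
Same conclusions as §§1–2 (`< A·epochAllowance …`, `< youngAllowance ≤ youngWindow`); §4c checks joint inhabitation of
the (P5₂) hypothesis list on `twoMerge`.  Nothing printed is asserted; every v1 declaration above is unchanged.
[folklore]
-/

section Rescale

/-! ### §4a General `q ≥ 1`: threshold (P5_q) -/

/-- **LEMMA Y ON THE GENEALOGY LEDGER, RESCALED BIRTH UNIT.**  As `lifetime_lt_of_ledger`, the two size inputs now
carrying the new-part constant `q·(2·14^d)` (`q ≥ 1`) — `hfnd`: per foundation `size ℓ + 1 ≤ q·(2·14^d)·fmass ℓ`;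
`hev`: per event `size (product e) + 2 ≤ C·Σ_{consumed}(size + 1) + 2·#consumed + q·(2·14^d)·gmass e` — and (P5_q)
`q·c_e ≤ c_s·p̄₀` in place of (P5); the conclusion is unchanged, `< A·epochAllowance d C R_max A`.  The eight data
binders are supplied by `Ledger.lifetime_binders` at `a = q·(2·14^d)`; the skeleton is
`…T4BankAgeYoung.lifetime_lt_rescaled` (`f ↦ q·f`, `D ↦ q·D`, `c_s ↦ c_s/q`). [folklore] -/
theorem lifetime_lt_of_ledger_rescaled (L : T4Genealogy.Ledger κ) (hW : L.WF) {C : ℝ} (hC : 1 ≤ C) {d : ℕ}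
    (hd : 1 ≤ d) {q : ℕ} (hq : 1 ≤ q)
    (hfnd : ∀ e, e ≤ L.E → ∀ ℓ ∈ L.founded e, L.size ℓ + 1 ≤ q * (2 * 14 ^ d) * L.fmass ℓ)
    (hev : ∀ e, e < L.E → L.size (L.product e) + 2 ≤
      C * ∑ ℓ ∈ L.consumed e, (L.size ℓ + 1) + 2 * ((L.consumed e).card : ℝ) + q * (2 * 14 ^ d) * L.gmass e)
    {m D A : ℕ} (hm : L.E ≤ m) (hDD : L.Dtot ≤ (D : ℝ))
    {ce cs p₀ b : ℝ} (hce : 0 < ce) (hp : 0 < p₀) (hP5q : q * ce ≤ cs * p₀)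
    (hb : ce * p₀ * m + cs * p₀ ^ 2 * D ≤ b) (hbA : b < ce * p₀ * A)
    {R : ℕ → ℝ} {d' : ℕ → ℕ → ℝ} {len : ℕ → ℕ} {Rmax : ℝ} (hRmax : 0 ≤ Rmax)
    (hint : ∀ i, i ≤ m → ∀ k, 0 < d' i k → 1 ≤ d' i k)
    (hhalf : ∀ i, i ≤ m → ∀ k, 1 < k → d' i k ≤ (1 / 2) ^ k * L.σ i)
    (hlen : ∀ i, i ≤ m → ∃ k : ℕ, (k = 0 ∨ 0 < d' i k) ∧ (len i : ℝ) ≤ k + R i)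
    (hR : ∀ i, i ≤ m → R i ≤ Rmax) :
    (∑ i ∈ Finset.range (m + 1), (len i : ℝ)) < A * T4BankAgeYoung.epochAllowance d C Rmax A := by
  obtain ⟨hf, hv, hΨ0, hfound, hstep, hD, hV, hσ⟩ := L.lifetime_binders hW hC hd hfnd hev hm hDD
  exact T4BankAgeYoung.lifetime_lt_rescaled hq hce hp hP5q hb hbA hC d hf hv hΨ0 hfound hstep hD hV hRmax hσ hint
    hhalf hlen hR

/-- As `lifetime_lt_flow_of_ledger` (the typed (2.5) windows of a flow), with the rescaled birth unit `q·(2·14^d)` in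
`hfnd` / `hev` and (P5_q); skeleton `…T4BankAgeYoung.lifetime_lt_flow_rescaled`. [folklore] -/
theorem lifetime_lt_flow_of_ledger_rescaled (L : T4Genealogy.Ledger κ) (hW : L.WF) {C : ℝ} (hC : 1 ≤ C) {d : ℕ}
    (hd : 1 ≤ d) {q : ℕ} (hq : 1 ≤ q)
    (hfnd : ∀ e, e ≤ L.E → ∀ ℓ ∈ L.founded e, L.size ℓ + 1 ≤ q * (2 * 14 ^ d) * L.fmass ℓ)
    (hev : ∀ e, e < L.E → L.size (L.product e) + 2 ≤
      C * ∑ ℓ ∈ L.consumed e, (L.size ℓ + 1) + 2 * ((L.consumed e).card : ℝ) + q * (2 * 14 ^ d) * L.gmass e)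
    {m D A : ℕ} (hm : L.E ≤ m) (hDD : L.Dtot ≤ (D : ℝ))
    {ce cs p₀ b : ℝ} (hce : 0 < ce) (hp : 0 < p₀) (hP5q : q * ce ≤ cs * p₀)
    (hb : ce * p₀ * m + cs * p₀ ^ 2 * D ≤ b) (hbA : b < ce * p₀ * A)
    {d' : ℕ → ℕ → ℝ} {len : ℕ → ℕ}
    (hint : ∀ i, i ≤ m → ∀ k, 0 < d' i k → 1 ≤ d' i k)
    (hhalf : ∀ i, i ≤ m → ∀ k, 1 < k → d' i k ≤ (1 / 2) ^ k * L.σ i)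
    (F : Flow) (K : ℕ) {β' : ℝ} (hβ' : 0 ≤ β') {L₁ r : ℕ} (hL : 1 ≤ L₁)
    (hpos : ∀ j, j ≤ K → 0 < F.g j) (hle1 : ∀ j, j ≤ K → F.g j ≤ 1) (hrg : F.SatisfiesRG K)
    (hub : ∀ j, j < K → F.β (j + 1) (F.g j) ≤ β') (R : ℕ → ℕ) (hRj : ∀ j, j ≤ K → B14.IsRj L₁ r (F.g j) (R j))
    {x c : ℝ} (hx : 0 ≤ x) (hc : 0 ≤ c) (hxK : Real.log ((F.g K) ^ 2)⁻¹ ≤ x) (hcK : (F.g K) ^ 2 * β' ≤ c)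
    {s : ℕ → ℕ} (hs : ∀ i, i ≤ m → s i ≤ K)
    (hlen : ∀ i, i ≤ m → ∃ k : ℕ, (k = 0 ∨ 0 < d' i k) ∧ (len i : ℝ) ≤ k + R (s i)) :
    (∑ i ∈ Finset.range (m + 1), (len i : ℝ)) <
      A * T4BankAgeYoung.epochAllowance d C (T4BankAgeYoung.windowMax L₁ r x c K) A := by
  obtain ⟨hf, hv, hΨ0, hfound, hstep, hD, hV, hσ⟩ := L.lifetime_binders hW hC hd hfnd hev hm hDD
  exact T4BankAgeYoung.lifetime_lt_flow_rescaled hq hce hp hP5q hb hbA hC d hf hv hΨ0 hfound hstep hD hV hσ hint hhalf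
    F K hβ' hL hpos hle1 hrg hub R hRj hx hc hxK hcK hs hlen

/-- As `lifetime_lt_youngWindow_of_ledger` (the link (Y3) at `A = ageCut C′ K`), with the rescaled birth unit
`q·(2·14^d)` in `hfnd` / `hev` and (P5_q); skeleton `…T4BankAgeYoung.lifetime_lt_youngWindow_rescaled`. [folklore] -/
theorem lifetime_lt_youngWindow_of_ledger_rescaled (L : T4Genealogy.Ledger κ) (hW : L.WF) {C : ℝ} (hC : 1 ≤ C)
    {d : ℕ} (hd : 1 ≤ d) {q : ℕ} (hq : 1 ≤ q)
    (hfnd : ∀ e, e ≤ L.E → ∀ ℓ ∈ L.founded e, L.size ℓ + 1 ≤ q * (2 * 14 ^ d) * L.fmass ℓ)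
    (hev : ∀ e, e < L.E → L.size (L.product e) + 2 ≤
      C * ∑ ℓ ∈ L.consumed e, (L.size ℓ + 1) + 2 * ((L.consumed e).card : ℝ) + q * (2 * 14 ^ d) * L.gmass e)
    {m D : ℕ} {C' : ℝ} {K : ℕ} (hm : L.E ≤ m) (hDD : L.Dtot ≤ (D : ℝ))
    {ce cs p₀ b : ℝ} (hce : 0 < ce) (hp : 0 < p₀) (hP5q : q * ce ≤ cs * p₀)
    (hb : ce * p₀ * m + cs * p₀ ^ 2 * D ≤ b) (hbA : b < ce * p₀ * (T4RemnantBooking.ageCut C' K))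
    {d' : ℕ → ℕ → ℝ} {len : ℕ → ℕ}
    (hint : ∀ i, i ≤ m → ∀ k, 0 < d' i k → 1 ≤ d' i k)
    (hhalf : ∀ i, i ≤ m → ∀ k, 1 < k → d' i k ≤ (1 / 2) ^ k * L.σ i)
    (F : Flow) {β' : ℝ} (hβ' : 0 ≤ β') {L₁ r : ℕ} (hL : 1 ≤ L₁)
    (hpos : ∀ j, j ≤ K → 0 < F.g j) (hle1 : ∀ j, j ≤ K → F.g j ≤ 1) (hrg : F.SatisfiesRG K)
    (hub : ∀ j, j < K → F.β (j + 1) (F.g j) ≤ β') (R : ℕ → ℕ) (hRj : ∀ j, j ≤ K → B14.IsRj L₁ r (F.g j) (R j))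
    {x c : ℝ} (hx : 0 ≤ x) (hc : 0 ≤ c) (hxK : Real.log ((F.g K) ^ 2)⁻¹ ≤ x) (hcK : (F.g K) ^ 2 * β' ≤ c)
    {s : ℕ → ℕ} (hs : ∀ i, i ≤ m → s i ≤ K)
    (hlen : ∀ i, i ≤ m → ∃ k : ℕ, (k = 0 ∨ 0 < d' i k) ∧ (len i : ℝ) ≤ k + R (s i)) :
    (∑ i ∈ Finset.range (m + 1), (len i : ℝ)) < T4BankAgeYoung.youngAllowance d L₁ r C C' x c K ∧
      (∑ i ∈ Finset.range (m + 1), (len i : ℝ)) < (T4BankAgeYoung.youngWindow d L₁ r C C' x c K : ℝ) := by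
  obtain ⟨hf, hv, hΨ0, hfound, hstep, hD, hV, hσ⟩ := L.lifetime_binders hW hC hd hfnd hev hm hDD
  exact T4BankAgeYoung.lifetime_lt_youngWindow_rescaled hq hce hp hP5q hb hbA hC d hf hv hΨ0 hfound hstep hD hV hσ hint
    hhalf F hβ' hL hpos hle1 hrg hub R hRj hx hc hxK hcK hs hlen

/-- As `lifetime_lt_of_ledger_cover` (§2: the profile binders `hint` / `hhalf` DISCHARGED on the cover profiles of the
epoch bases `Z i` by `…T4EpochSize.coverProfile_int` / `coverProfile_halving` under `treeLen (Z i) ≤ L.σ i`), with the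
rescaled birth unit `q·(2·14^d)` in `hfnd` / `hev` and (P5_q). [folklore] -/
theorem lifetime_lt_of_ledger_cover_rescaled (L : T4Genealogy.Ledger κ) (hW : L.WF) {C : ℝ} (hC : 1 ≤ C) {d : ℕ}
    (hd : 1 ≤ d) {q : ℕ} (hq : 1 ≤ q)
    (hfnd : ∀ e, e ≤ L.E → ∀ ℓ ∈ L.founded e, L.size ℓ + 1 ≤ q * (2 * 14 ^ d) * L.fmass ℓ)
    (hev : ∀ e, e < L.E → L.size (L.product e) + 2 ≤
      C * ∑ ℓ ∈ L.consumed e, (L.size ℓ + 1) + 2 * ((L.consumed e).card : ℝ) + q * (2 * 14 ^ d) * L.gmass e)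
    {m D A : ℕ} (hm : L.E ≤ m) (hDD : L.Dtot ≤ (D : ℝ))
    {ce cs p₀ b : ℝ} (hce : 0 < ce) (hp : 0 < p₀) (hP5q : q * ce ≤ cs * p₀)
    (hb : ce * p₀ * m + cs * p₀ ^ 2 * D ≤ b) (hbA : b < ce * p₀ * A)
    {L₀ : ℕ} (hL₀ : 4 ≤ L₀) {sc : ℕ → ℕ → ℕ} {hor : ℕ → ℕ}
    (hdrop : ∀ i, i ≤ m → B16SProfile.DropCtl (sc i) (hor i))
    {Z : ℕ → Finset (B13ScaleTransfer.Pt d)} (hZ : ∀ i, i ≤ m → (Z i).Nonempty)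
    (hZc : ∀ i, i ≤ m → B13ScaleTransfer.FaceConnected (Z i))
    (hZσ : ∀ i, i ≤ m → TreeLength.treeLen (Z i) ≤ L.σ i)
    {R : ℕ → ℝ} {len : ℕ → ℕ} {Rmax : ℝ} (hRmax : 0 ≤ Rmax)
    (hlen : ∀ i, i ≤ m → ∃ k : ℕ, (k = 0 ∨ 0 < T4EpochSize.coverProfile L₀ (sc i) (hor i) (Z i) k) ∧
      (len i : ℝ) ≤ k + R i)
    (hR : ∀ i, i ≤ m → R i ≤ Rmax) :
    (∑ i ∈ Finset.range (m + 1), (len i : ℝ)) < A * T4BankAgeYoung.epochAllowance d C Rmax A := by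
  have hint : ∀ i, i ≤ m → ∀ k, 0 < T4EpochSize.coverProfile L₀ (sc i) (hor i) (Z i) k →
      1 ≤ T4EpochSize.coverProfile L₀ (sc i) (hor i) (Z i) k :=
    fun i _ => T4EpochSize.coverProfile_int (Z i)
  have hhalf : ∀ i, i ≤ m → ∀ k, 1 < k →
      T4EpochSize.coverProfile L₀ (sc i) (hor i) (Z i) k ≤ (1 / 2) ^ k * L.σ i := by
    intro i hi k hk
    have h1 := T4EpochSize.coverProfile_halving hL₀ (hdrop i hi) (hZ i hi) (hZc i hi) k hk
    have h2 : (1 / 2 : ℝ) ^ k * TreeLength.treeLen (Z i) ≤ (1 / 2) ^ k * L.σ i :=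
      mul_le_mul_of_nonneg_left (hZσ i hi) (by positivity)
    exact h1.trans h2
  exact lifetime_lt_of_ledger_rescaled L hW hC hd hq hfnd hev hm hDD hce hp hP5q hb hbA
    (d' := fun i => T4EpochSize.coverProfile L₀ (sc i) (hor i) (Z i)) hRmax hint hhalf hlen hR

/-! ### §4b The model instance `q = 2`: new-part constant `4·14^d`, threshold (P5₂) -/

/-- **LEMMA Y ON THE GENEALOGY LEDGER WITH THE MODEL'S NEW-PART CONSTANT `4·14^d`.**  As `lifetime_lt_of_ledger`, the
two size inputs in the `4·14^d`-shapes of `Ledger.lifetime_binders_four` — `hfnd`: `size ℓ + 1 ≤ 4·14^d·fmass ℓ`; `hev`: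
`… + 4·14^d·gmass e` (on a geometric realisation exactly `…T4GeometricLedger.hfnd_of_geometric` / `hev_of_geometric`
with `C = T4EpochSize.modelC d`) — and (P5₂) `2·c_e ≤ c_s·p̄₀` in place of (P5), the birth total `Dtot ≤ D` undoubled;
same conclusion.  Skeleton `…T4BankAgeYoung.lifetime_lt_four`. [folklore] -/
theorem lifetime_lt_of_ledger_four (L : T4Genealogy.Ledger κ) (hW : L.WF) {C : ℝ} (hC : 1 ≤ C) {d : ℕ} (hd : 1 ≤ d)
    (hfnd : ∀ e, e ≤ L.E → ∀ ℓ ∈ L.founded e, L.size ℓ + 1 ≤ 4 * 14 ^ d * L.fmass ℓ)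
    (hev : ∀ e, e < L.E → L.size (L.product e) + 2 ≤
      C * ∑ ℓ ∈ L.consumed e, (L.size ℓ + 1) + 2 * ((L.consumed e).card : ℝ) + 4 * 14 ^ d * L.gmass e)
    {m D A : ℕ} (hm : L.E ≤ m) (hDD : L.Dtot ≤ (D : ℝ))
    {ce cs p₀ b : ℝ} (hce : 0 < ce) (hp : 0 < p₀) (hP5₂ : 2 * ce ≤ cs * p₀)
    (hb : ce * p₀ * m + cs * p₀ ^ 2 * D ≤ b) (hbA : b < ce * p₀ * A)
    {R : ℕ → ℝ} {d' : ℕ → ℕ → ℝ} {len : ℕ → ℕ} {Rmax : ℝ} (hRmax : 0 ≤ Rmax)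
    (hint : ∀ i, i ≤ m → ∀ k, 0 < d' i k → 1 ≤ d' i k)
    (hhalf : ∀ i, i ≤ m → ∀ k, 1 < k → d' i k ≤ (1 / 2) ^ k * L.σ i)
    (hlen : ∀ i, i ≤ m → ∃ k : ℕ, (k = 0 ∨ 0 < d' i k) ∧ (len i : ℝ) ≤ k + R i)
    (hR : ∀ i, i ≤ m → R i ≤ Rmax) :
    (∑ i ∈ Finset.range (m + 1), (len i : ℝ)) < A * T4BankAgeYoung.epochAllowance d C Rmax A := by
  obtain ⟨hf, hv, hΨ0, hfound, hstep, hD, hV, hσ⟩ := L.lifetime_binders_four hW hC hd hfnd hev hm hDD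
  exact T4BankAgeYoung.lifetime_lt_four hce hp hP5₂ hb hbA hC d hf hv hΨ0 hfound hstep hD hV hRmax hσ hint hhalf hlen hR

/-- As `lifetime_lt_flow_of_ledger`, with the `4·14^d`-shapes in `hfnd` / `hev` and (P5₂): the instance `q = 2` of
`lifetime_lt_flow_of_ledger_rescaled` (`4·14^d = 2·(2·14^d)`). [folklore] -/
theorem lifetime_lt_flow_of_ledger_four (L : T4Genealogy.Ledger κ) (hW : L.WF) {C : ℝ} (hC : 1 ≤ C) {d : ℕ}
    (hd : 1 ≤ d)
    (hfnd : ∀ e, e ≤ L.E → ∀ ℓ ∈ L.founded e, L.size ℓ + 1 ≤ 4 * 14 ^ d * L.fmass ℓ)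
    (hev : ∀ e, e < L.E → L.size (L.product e) + 2 ≤
      C * ∑ ℓ ∈ L.consumed e, (L.size ℓ + 1) + 2 * ((L.consumed e).card : ℝ) + 4 * 14 ^ d * L.gmass e)
    {m D A : ℕ} (hm : L.E ≤ m) (hDD : L.Dtot ≤ (D : ℝ))
    {ce cs p₀ b : ℝ} (hce : 0 < ce) (hp : 0 < p₀) (hP5₂ : 2 * ce ≤ cs * p₀)
    (hb : ce * p₀ * m + cs * p₀ ^ 2 * D ≤ b) (hbA : b < ce * p₀ * A)
    {d' : ℕ → ℕ → ℝ} {len : ℕ → ℕ}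
    (hint : ∀ i, i ≤ m → ∀ k, 0 < d' i k → 1 ≤ d' i k)
    (hhalf : ∀ i, i ≤ m → ∀ k, 1 < k → d' i k ≤ (1 / 2) ^ k * L.σ i)
    (F : Flow) (K : ℕ) {β' : ℝ} (hβ' : 0 ≤ β') {L₁ r : ℕ} (hL : 1 ≤ L₁)
    (hpos : ∀ j, j ≤ K → 0 < F.g j) (hle1 : ∀ j, j ≤ K → F.g j ≤ 1) (hrg : F.SatisfiesRG K)
    (hub : ∀ j, j < K → F.β (j + 1) (F.g j) ≤ β') (R : ℕ → ℕ) (hRj : ∀ j, j ≤ K → B14.IsRj L₁ r (F.g j) (R j))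
    {x c : ℝ} (hx : 0 ≤ x) (hc : 0 ≤ c) (hxK : Real.log ((F.g K) ^ 2)⁻¹ ≤ x) (hcK : (F.g K) ^ 2 * β' ≤ c)
    {s : ℕ → ℕ} (hs : ∀ i, i ≤ m → s i ≤ K)
    (hlen : ∀ i, i ≤ m → ∃ k : ℕ, (k = 0 ∨ 0 < d' i k) ∧ (len i : ℝ) ≤ k + R (s i)) :
    (∑ i ∈ Finset.range (m + 1), (len i : ℝ)) <
      A * T4BankAgeYoung.epochAllowance d C (T4BankAgeYoung.windowMax L₁ r x c K) A :=
  lifetime_lt_flow_of_ledger_rescaled L hW hC hd (q := 2) (by norm_num)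
    (fun e he ℓ hℓ => (hfnd e he ℓ hℓ).trans (le_of_eq (by push_cast; ring)))
    (fun e he => (hev e he).trans (le_of_eq (by push_cast; ring))) hm hDD hce hp (by push_cast; linarith) hb hbA
    hint hhalf F K hβ' hL hpos hle1 hrg hub R hRj hx hc hxK hcK hs hlen

/-- As `lifetime_lt_youngWindow_of_ledger` (the link (Y3)), with the `4·14^d`-shapes in `hfnd` / `hev` and (P5₂);
skeleton `…T4BankAgeYoung.lifetime_lt_youngWindow_four`. [folklore] -/
theorem lifetime_lt_youngWindow_of_ledger_four (L : T4Genealogy.Ledger κ) (hW : L.WF) {C : ℝ} (hC : 1 ≤ C) {d : ℕ}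
    (hd : 1 ≤ d)
    (hfnd : ∀ e, e ≤ L.E → ∀ ℓ ∈ L.founded e, L.size ℓ + 1 ≤ 4 * 14 ^ d * L.fmass ℓ)
    (hev : ∀ e, e < L.E → L.size (L.product e) + 2 ≤
      C * ∑ ℓ ∈ L.consumed e, (L.size ℓ + 1) + 2 * ((L.consumed e).card : ℝ) + 4 * 14 ^ d * L.gmass e)
    {m D : ℕ} {C' : ℝ} {K : ℕ} (hm : L.E ≤ m) (hDD : L.Dtot ≤ (D : ℝ))
    {ce cs p₀ b : ℝ} (hce : 0 < ce) (hp : 0 < p₀) (hP5₂ : 2 * ce ≤ cs * p₀)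
    (hb : ce * p₀ * m + cs * p₀ ^ 2 * D ≤ b) (hbA : b < ce * p₀ * (T4RemnantBooking.ageCut C' K))
    {d' : ℕ → ℕ → ℝ} {len : ℕ → ℕ}
    (hint : ∀ i, i ≤ m → ∀ k, 0 < d' i k → 1 ≤ d' i k)
    (hhalf : ∀ i, i ≤ m → ∀ k, 1 < k → d' i k ≤ (1 / 2) ^ k * L.σ i)
    (F : Flow) {β' : ℝ} (hβ' : 0 ≤ β') {L₁ r : ℕ} (hL : 1 ≤ L₁)
    (hpos : ∀ j, j ≤ K → 0 < F.g j) (hle1 : ∀ j, j ≤ K → F.g j ≤ 1) (hrg : F.SatisfiesRG K)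
    (hub : ∀ j, j < K → F.β (j + 1) (F.g j) ≤ β') (R : ℕ → ℕ) (hRj : ∀ j, j ≤ K → B14.IsRj L₁ r (F.g j) (R j))
    {x c : ℝ} (hx : 0 ≤ x) (hc : 0 ≤ c) (hxK : Real.log ((F.g K) ^ 2)⁻¹ ≤ x) (hcK : (F.g K) ^ 2 * β' ≤ c)
    {s : ℕ → ℕ} (hs : ∀ i, i ≤ m → s i ≤ K)
    (hlen : ∀ i, i ≤ m → ∃ k : ℕ, (k = 0 ∨ 0 < d' i k) ∧ (len i : ℝ) ≤ k + R (s i)) :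
    (∑ i ∈ Finset.range (m + 1), (len i : ℝ)) < T4BankAgeYoung.youngAllowance d L₁ r C C' x c K ∧
      (∑ i ∈ Finset.range (m + 1), (len i : ℝ)) < (T4BankAgeYoung.youngWindow d L₁ r C C' x c K : ℝ) := by
  obtain ⟨hf, hv, hΨ0, hfound, hstep, hD, hV, hσ⟩ := L.lifetime_binders_four hW hC hd hfnd hev hm hDD
  exact T4BankAgeYoung.lifetime_lt_youngWindow_four hce hp hP5₂ hb hbA hC d hf hv hΨ0 hfound hstep hD hV hσ hint hhalf F
    hβ' hL hpos hle1 hrg hub R hRj hx hc hxK hcK hs hlen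

/-- **LEMMA Y ON THE GENEALOGY LEDGER WITH THE COVER PROFILES AND THE MODEL'S CONSTANT `4·14^d`.**  As
`lifetime_lt_of_ledger_cover` (§2), with the `4·14^d`-shapes in `hfnd` / `hev` and (P5₂): on a geometric realisation
(`…T4GeometricLedger`, undoubled ledger `toLedger`) every model-side binder of this theorem is supplied by name
(`wf_of_geometric`, `hfnd_of_geometric`, `hev_of_geometric`, `treeLen (dom (base i)) = σ i`), leaving the S-side
credit reading with (P5₂) and `Dtot ≤ D`, the printed horizon `hlen` / `hR`, and `1 ≤ d`. [folklore] -/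
theorem lifetime_lt_of_ledger_cover_four (L : T4Genealogy.Ledger κ) (hW : L.WF) {C : ℝ} (hC : 1 ≤ C) {d : ℕ}
    (hd : 1 ≤ d)
    (hfnd : ∀ e, e ≤ L.E → ∀ ℓ ∈ L.founded e, L.size ℓ + 1 ≤ 4 * 14 ^ d * L.fmass ℓ)
    (hev : ∀ e, e < L.E → L.size (L.product e) + 2 ≤
      C * ∑ ℓ ∈ L.consumed e, (L.size ℓ + 1) + 2 * ((L.consumed e).card : ℝ) + 4 * 14 ^ d * L.gmass e)
    {m D A : ℕ} (hm : L.E ≤ m) (hDD : L.Dtot ≤ (D : ℝ))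
    {ce cs p₀ b : ℝ} (hce : 0 < ce) (hp : 0 < p₀) (hP5₂ : 2 * ce ≤ cs * p₀)
    (hb : ce * p₀ * m + cs * p₀ ^ 2 * D ≤ b) (hbA : b < ce * p₀ * A)
    {L₀ : ℕ} (hL₀ : 4 ≤ L₀) {sc : ℕ → ℕ → ℕ} {hor : ℕ → ℕ}
    (hdrop : ∀ i, i ≤ m → B16SProfile.DropCtl (sc i) (hor i))
    {Z : ℕ → Finset (B13ScaleTransfer.Pt d)} (hZ : ∀ i, i ≤ m → (Z i).Nonempty)
    (hZc : ∀ i, i ≤ m → B13ScaleTransfer.FaceConnected (Z i))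
    (hZσ : ∀ i, i ≤ m → TreeLength.treeLen (Z i) ≤ L.σ i)
    {R : ℕ → ℝ} {len : ℕ → ℕ} {Rmax : ℝ} (hRmax : 0 ≤ Rmax)
    (hlen : ∀ i, i ≤ m → ∃ k : ℕ, (k = 0 ∨ 0 < T4EpochSize.coverProfile L₀ (sc i) (hor i) (Z i) k) ∧
      (len i : ℝ) ≤ k + R i)
    (hR : ∀ i, i ≤ m → R i ≤ Rmax) :
    (∑ i ∈ Finset.range (m + 1), (len i : ℝ)) < A * T4BankAgeYoung.epochAllowance d C Rmax A := by
  have hint : ∀ i, i ≤ m → ∀ k, 0 < T4EpochSize.coverProfile L₀ (sc i) (hor i) (Z i) k →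
      1 ≤ T4EpochSize.coverProfile L₀ (sc i) (hor i) (Z i) k :=
    fun i _ => T4EpochSize.coverProfile_int (Z i)
  have hhalf : ∀ i, i ≤ m → ∀ k, 1 < k →
      T4EpochSize.coverProfile L₀ (sc i) (hor i) (Z i) k ≤ (1 / 2) ^ k * L.σ i := by
    intro i hi k hk
    have h1 := T4EpochSize.coverProfile_halving hL₀ (hdrop i hi) (hZ i hi) (hZc i hi) k hk
    have h2 : (1 / 2 : ℝ) ^ k * TreeLength.treeLen (Z i) ≤ (1 / 2) ^ k * L.σ i :=
      mul_le_mul_of_nonneg_left (hZσ i hi) (by positivity)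
    exact h1.trans h2
  exact lifetime_lt_of_ledger_four L hW hC hd hfnd hev hm hDD hce hp hP5₂ hb hbA
    (d' := fun i => T4EpochSize.coverProfile L₀ (sc i) (hor i) (Z i)) hRmax hint hhalf hlen hR

/-! ### §4c Non-vacuity of the (P5₂) hypothesis list -/

open T4Genealogy T4Genealogy.Ledger in
/-- NON-VACUITY: the hypotheses of `lifetime_lt_of_ledger_four` are JOINTLY INHABITED by the two-founder / one-merger
ledger `…T4Genealogy.Ledger.twoMerge` with `C = 1`, `d = 1`, `m = E = 1`, `D = 2 = Dtot` (undoubled), `c_e = p̄₀ = 1`,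
`c_s = 2` (so (P5₂) holds with equality), bank `b = 5 = 1·1·1 + 2·1·2 < 1·1·A` at `A = 6`, zero profiles / windows /
lifetimes; the size inputs hold in the `4·14^1`-shapes (`2 ≤ 56`, `7 ≤ 8`) and the theorem is APPLIED, its conclusion
reading `Σ_{i ≤ 1} 0 < 6·epochAllowance 1 1 0 6`.  (Inhabitation of the hypothesis list only; nothing about print.)
[folklore] -/
theorem lifetime_lt_of_ledger_four_nonvacuous :
    twoMerge.WF ∧ twoMerge.E = 1 ∧ twoMerge.Dtot = 2 ∧
    (∑ i ∈ Finset.range (1 + 1), ((fun _ : ℕ => (0 : ℕ)) i : ℝ)) <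
      ((6 : ℕ) : ℝ) * T4BankAgeYoung.epochAllowance 1 1 0 6 := by
  have hW : twoMerge.WF := by
    refine ⟨by simp [twoMerge], ?_, ?_, ?_, ?_⟩
    · intro e he
      have he0 : e = 0 := by simp [twoMerge] at he; omega
      subst he0
      simp [twoMerge]
    · intro ℓ; simp only [twoMerge]; split_ifs <;> norm_num
    · intro e ℓ _; simp [twoMerge]
    · intro e; simp [twoMerge]
  have hE : twoMerge.E = 1 := rfl
  have hDtot : twoMerge.Dtot = 2 := by
    rw [Dtot, hE, Finset.sum_range_succ, Finset.sum_range_one, f_zero,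
      twoMerge.f_succ_of_lt (show 0 < twoMerge.E from by rw [hE]; exact Nat.one_pos)]
    norm_num [twoMerge]
  have hfnd : ∀ e, e ≤ twoMerge.E → ∀ ℓ ∈ twoMerge.founded e,
      twoMerge.size ℓ + 1 ≤ 4 * 14 ^ (1 : ℕ) * twoMerge.fmass ℓ := by
    intro e _ ℓ hℓ
    simp only [twoMerge] at hℓ ⊢
    split_ifs at hℓ with h
    · simp at hℓ
      rcases hℓ with rfl | rfl <;> norm_num
    · simp at hℓ
  have hev : ∀ e, e < twoMerge.E → twoMerge.size (twoMerge.product e) + 2 ≤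
      1 * ∑ ℓ ∈ twoMerge.consumed e, (twoMerge.size ℓ + 1) + 2 * ((twoMerge.consumed e).card : ℝ)
        + 4 * 14 ^ (1 : ℕ) * twoMerge.gmass e := by
    intro e he
    have he0 : e = 0 := by simp [twoMerge] at he; omega
    subst he0
    simp [twoMerge]
    norm_num
  have hσnn : ∀ i, 0 ≤ twoMerge.σ i := by
    intro i
    cases i with
    | zero => simpa using hW.size_nonneg twoMerge.base₀
    | succ e =>
      by_cases he : e < twoMerge.E
      · rw [twoMerge.σ_succ_of_lt he]; exact hW.size_nonneg _
      · rw [twoMerge.σ_succ_of_le (not_lt.mp he)]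
  refine ⟨hW, hE, hDtot, ?_⟩
  exact lifetime_lt_of_ledger_four twoMerge hW (C := 1) le_rfl (d := 1) le_rfl hfnd hev (m := 1) (D := 2) (A := 6)
    (by rw [hE]) (by rw [hDtot]; norm_num) (ce := 1) (cs := 2) (p₀ := 1) (b := 5) one_pos one_pos (by norm_num)
    (by norm_num) (by norm_num) (R := fun _ => 0) (d' := fun _ _ => 0) (len := fun _ => 0) (Rmax := 0) le_rfl
    (fun i _ k hk => absurd hk (lt_irrefl _))
    (fun i _ k _ => by simpa using mul_nonneg (by positivity : (0 : ℝ) ≤ (1 / 2) ^ k) (hσnn i))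
    (fun i _ => ⟨0, Or.inl rfl, by simp⟩) (fun i _ => le_rfl)

end Rescale

end Literature.MathematicalPhysics.QuantumFieldTheory.Balaban1983to89.T4GenealogyLifetime
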